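/-
Origin: expansion seat `planner-pub-hodgecm-pv15-g2-0`, handover #7 2026-08-18T07:09:16Z (`HOME/pub-hodgecm-pv15-g2/lean/Pv15g2/UnfoldAnnihilation.lean`, md5 d6bd1c1a, 224 lines);
landed by the gen-7 packager in gate run 25 as `HodgeCM/Automorphic/UnfoldAnnihilation.lean` (import ^import Pv15g2\.→import HodgeCM.Automorphic. ×1).
-/
/-
Origin: HOME/pub-hodgecm-pv15-g2/lean/Pv15g2/UnfoldAnnihilation.lean — session planner-pub-hodgecm-pv15-g2-0
(unit pub-hodgecm-pv15-g2, DAG-NODE PROVER #15 gen 2; lineage N23a / N23c input `unfold` [AX12(ii)]).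
Intended final place (packager's call): `HodgeCM/Automorphic/UnfoldAnnihilation.lean`.
NEW, ADDITIVE; imports my queued `Pv15g2.KernelUnfolding` (↦ `HodgeCM.Automorphic.KernelUnfolding`, run 25) and the
LANDED `HodgeCM.Automorphic.CocompactCarrier` (run 24), `HodgeCM.PerL34.Vanishing` (pv06 gen 1, run 20).
KIND: KERNEL — nothing cited, nothing posited, no `Universe`.
-/
import Summits.HodgeConjecture.HodgeCM.Automorphic.KernelUnfolding
import Summits.HodgeConjecture.HodgeCM.Automorphic.CocompactCarrier
import Summits.HodgeConjecture.HodgeCM.PerL34.Vanishing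

/-!
# PerL Prop 3.6 Step 2, first move (tex ll. 423–426) on the coset space: `v ⟂ 𝓔 ⇒` every toric coefficient vanishes

This is the input labelled `unfold` **[AX12(ii)]** in pv06-g3's `QuotientTorusDatum` / `CompactTorusDatum`
(`HodgeCM/PerL34/AnnihilationModel.lean`, their 07:04Z v3: "NET RESIDUAL of N23c per torus side … `unfold` [AX12(ii)] +
`hsep`, `dense` [PRINT]"), proved here at kernel level in the quotient (`L²(G ⧸ Γ)`) model, for the β-weighted toric
period.  Statement (`RegularRep.toricCoeff_eq_zero_of_orthogonal_EisL2`): in the cocompact Haar model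
(`IsCocompactHaarModel Γ μQ μ`), for a continuous `x : C(G ⧸ Γ, ℂ)`,

  `(∀ f ∈ C_c(G, ℂ), ⟪E^χ_f, x⟫_{L²(μQ)} = 0)  ⟹  ∀ h ∈ G, ∫_T β(t) conj χ(t) · x(π((jT t · h)⁻¹)) dν(t) = 0`,

i.e. (`…_smul` form) `∫_T β conj χ (t) · (R(h)x)(π (jT t)⁻¹) dν = 0` with `(R(h)x)(q) = x(h⁻¹ • q)` — "the continuous
function `h ↦ P_{T,χ̄}(R(h)v)` vanishes identically" (l. 426), `P_{T,χ̄}` read as the β-weighted period over `T(𝔸)`.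

Proof = three LANDED/queued kernel pieces glued: (1) `⟪E^χ_f, x⟫ = ∫ conj(E^χ_f) · x dμQ` (Mathlib `L2.inner_def` + the
a.e. representatives `coeFn_EisL2`, `ContinuousMap.coeFn_toLp`); (2) my `KernelModel.unfolding_theta_quotient` (run-25
queue; the (U)-computation PerL ll. 413–417 transported to `G ⧸ Γ`) applied to the "kernel" `θ_y := y`, `ω(h)y := y(h⁻¹ • ·)`,
at `y := conj x`; (3) pv06's landed fundamental lemma `Vanishing.toricCoeff_eq_zero_of_forall_test_haar` (run 20) with
`v(y) := x(π(y⁻¹))`, `w := β · conj χ`.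

Also: `RegularRep.toricPeriodCLM ν w pt : C(Q, ℂ) →L[ℂ] ℂ`, `y ↦ ∫ w(t) y(pt t) dν` (the candidate `PT (emb χ)` of
pv06-g3's datum, with `w = β conj χ`, `pt t = π (jT t)⁻¹`), and `unfold_of_periodModel`: the `unfold` field's literal
shape `(∀ f, ⟪E χ f, toLp x⟫ = 0) → ∀ h, P (x(h⁻¹ • ·)) = 0` for ANY functional `P` agreeing with the β-period on
`C(G ⧸ Γ, ℂ)` — what then remains of `unfold` for a concrete `QuotientTorusDatum` is only that identification
[DEFINITIONAL: `PT (emb χ) y = ∫_T β conj χ · y ∘ pt dν`, i.e. β a `T(L₀)`-partition of unity on `T(𝔸)`, tex l. 405].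
-/

set_option autoImplicit false

noncomputable section

open MeasureTheory Set Filter Function
open scoped InnerProductSpace ENNReal ComplexConjugate CompactlySupported

namespace HodgeCM

namespace RegularRep

open HodgeCM.PerL34.N23a HodgeCM.PerL34

/-! ## 1. The β-weighted toric period as a continuous linear functional on `C(Q, ℂ)` -/

section PeriodCLM

variable {T : Type*} [TopologicalSpace T] [MeasurableSpace T] [OpensMeasurableSpace T]
  (ν : Measure T) [IsFiniteMeasureOnCompacts ν]
  {Q : Type*} [TopologicalSpace Q] [CompactSpace Q]
  {w : T → ℂ} (hw : Continuous w) (hws : HasCompactSupport w) {pt : T → Q} (hpt : Continuous pt)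

omit [CompactSpace Q] in
include hw hws hpt in
/-- (Ported verbatim from the HodgeCMPerL package; no docstring in the source.) -/
theorem integrable_mul_comp (y : C(Q, ℂ)) : Integrable (fun t => w t * y (pt t)) ν :=
  (hw.mul (y.continuous.comp hpt)).integrable_of_hasCompactSupport hws.mul_right

include hw hws in
/-- (Ported verbatim from the HodgeCMPerL package; no docstring in the source.) -/
theorem norm_integral_mul_comp_le (y : C(Q, ℂ)) :
    ‖∫ t, w t * y (pt t) ∂ν‖ ≤ (∫ t, ‖w t‖ ∂ν) * ‖y‖ := by
  have hwi : Integrable (fun t => ‖w t‖) ν := (hw.integrable_of_hasCompactSupport hws).norm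
  calc ‖∫ t, w t * y (pt t) ∂ν‖ ≤ ∫ t, ‖w t‖ * ‖y‖ ∂ν := by
        refine norm_integral_le_of_norm_le (hwi.mul_const _) (Eventually.of_forall fun t => ?_)
        rw [norm_mul]
        exact mul_le_mul_of_nonneg_left (y.norm_coe_le_norm (pt t)) (norm_nonneg _)
    _ = (∫ t, ‖w t‖ ∂ν) * ‖y‖ := integral_mul_const _ _

/-- **The β-weighted toric period** `y ↦ ∫_T w(t) y(pt t) dν(t)` as a continuous linear functional on `C(Q, ℂ)`
(`Q = G ⧸ Γ` compact, `w = β · conj χ` continuous with compact support, `pt t = π (jT t)⁻¹`). -/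
def toricPeriodCLM : C(Q, ℂ) →L[ℂ] ℂ :=
  LinearMap.mkContinuous
    { toFun := fun y => ∫ t, w t * y (pt t) ∂ν
      map_add' := fun y z => by
        simp only [ContinuousMap.add_apply, mul_add]
        exact integral_add (integrable_mul_comp ν hw hws hpt y) (integrable_mul_comp ν hw hws hpt z)
      map_smul' := fun c y => by
        simp only [ContinuousMap.smul_apply, smul_eq_mul, RingHom.id_apply, ← integral_const_mul]
        congr 1
        ext t
        ring }
    (∫ t, ‖w t‖ ∂ν) (fun y => norm_integral_mul_comp_le ν hw hws y)

/-- (Ported verbatim from the HodgeCMPerL package; no docstring in the source.) -/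
@[simp] theorem toricPeriodCLM_apply (y : C(Q, ℂ)) :
    toricPeriodCLM ν hw hws hpt y = ∫ t, w t * y (pt t) ∂ν := rfl

end PeriodCLM

/-! ## 2. The weight `β · conj χ` -/

section Weight

variable {T : Type*} [TopologicalSpace T] (β : C_c(T, ℝ)) (χ : C(T, ℂ))

/-- `conj (β(t) conj χ(t)) = β(t) χ(t)`. -/
theorem conj_wt_star (t : T) : conj (wt β (star χ) t) = wt β χ t := by
  simp only [wt, map_mul, Complex.conj_ofReal, Pi.star_apply, Complex.star_def, Complex.conj_conj]

/-- (Ported verbatim from the HodgeCMPerL package; no docstring in the source.) -/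
theorem continuous_wt_star : Continuous (wt β (star χ)) :=
  continuous_wt β.continuous (star χ).continuous

/-- (Ported verbatim from the HodgeCMPerL package; no docstring in the source.) -/
theorem hasCompactSupport_wt_star : HasCompactSupport (wt β (star χ)) :=
  (β.hasCompactSupport.comp_left Complex.ofReal_zero).mul_right

end Weight

/-! ## 3. `⟪E^χ_f, x⟫_{L²}` as an integral, and Step 2's first move -/

section Unfold

variable {G : Type*} [Group G] [TopologicalSpace G] [IsTopologicalGroup G] [T2Space G] [LocallyCompactSpace G]
  [MeasurableSpace G] [BorelSpace G]
  {Γ : Subgroup G} [MeasurableSpace (G ⧸ Γ)] [BorelSpace (G ⧸ Γ)] [T2Space (G ⧸ Γ)] [CompactSpace (G ⧸ Γ)]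
  {μQ : Measure (G ⧸ Γ)} [IsFiniteMeasure μQ]
  {T : Type*} [Group T] [TopologicalSpace T] [T2Space T] [MeasurableSpace T] [OpensMeasurableSpace T]
  (ν : Measure T) [IsFiniteMeasureOnCompacts ν] (jT : ContinuousMonoidHom T G) (β : C_c(T, ℝ)) (χ : C(T, ℂ))

omit [MeasurableSpace G] [BorelSpace G] [T2Space T] in
/-- `⟪E^χ_f, x⟫_{L²(μQ)} = ∫ conj(E^χ_f(q)) x(q) dμQ(q)` for a continuous `x` (a.e. representatives). -/
theorem inner_EisL2_toLp (hΓ : DiscreteMeets Γ) (f : C_c(G, ℂ)) (x : C(G ⧸ Γ, ℂ)) :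
    ⟪EisL2 μQ ν jT β χ hΓ f, ContinuousMap.toLp (E := ℂ) 2 μQ ℂ x⟫_ℂ
      = ∫ q, conj (EisQ Γ ν jT.toMonoidHom β χ f q) * x q ∂μQ := by
  rw [MeasureTheory.L2.inner_def]
  refine integral_congr_ae ?_
  filter_upwards [coeFn_EisL2 μQ ν jT β χ hΓ f,
    ContinuousMap.coeFn_toLp (E := ℂ) (p := 2) (μ := μQ) (𝕜 := ℂ) x] with q h1 h2
  rw [RCLike.inner_apply', h1, h2]

omit [MeasurableSpace G] [BorelSpace G] [T2Space T] in
/-- The conjugate pairing: `conj ⟪E^χ_f, x⟫ = ∫ conj(x(q)) E^χ_f(q) dμQ(q)`. -/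
theorem conj_inner_EisL2_toLp (hΓ : DiscreteMeets Γ) (f : C_c(G, ℂ)) (x : C(G ⧸ Γ, ℂ)) :
    conj ⟪EisL2 μQ ν jT β χ hΓ f, ContinuousMap.toLp (E := ℂ) 2 μQ ℂ x⟫_ℂ
      = ∫ q, conj (x q) * EisQ Γ ν jT.toMonoidHom β χ f q ∂μQ := by
  rw [inner_EisL2_toLp, ← integral_conj]
  congr 1
  ext q
  simp only [map_mul, RingHomCompTriple.comp_apply, RingHom.id_apply, mul_comm]

/-- **PerL v5 Prop 3.6 Step 2, ll. 423–426, on the coset space (= pv06-g3's `unfold` [AX12(ii)], β-weighted form).**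
In the cocompact Haar model, if the continuous function `x` on `G ⧸ Γ` is `L²(μQ)`-orthogonal to every pseudo-Eisenstein
vector `E^χ_f`, `f ∈ C_c(G)`, then for EVERY `h ∈ G` the β-weighted toric period of the right translate vanishes:
`∫_T β(t) conj χ(t) · x(π((jT t · h)⁻¹)) dν(t) = 0`. -/
theorem toricCoeff_eq_zero_of_orthogonal_EisL2 {μ : Measure G} (hM : IsCocompactHaarModel Γ μQ μ)
    (hΓ : DiscreteMeets Γ) (x : C(G ⧸ Γ, ℂ))
    (horth : ∀ f : C_c(G, ℂ), ⟪EisL2 μQ ν jT β χ hΓ f, ContinuousMap.toLp (E := ℂ) 2 μQ ℂ x⟫_ℂ = 0) (h : G) :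
    ∫ t, wt β (star χ) t * x (QuotientGroup.mk (jT t * h)⁻¹) ∂ν = 0 := by
  obtain ⟨𝓕, h𝓕, hμQ⟩ := hM.exists_fundamentalDomain
  haveI := hM.isHaar
  haveI := hM.regular
  haveI := hM.rightInvariant
  haveI := hM.countable
  -- the test vector `v(y) := x(π(y⁻¹))` on `G` and the weight `w := β conj χ`
  have hvc : Continuous fun y : G => x (QuotientGroup.mk y⁻¹) :=
    x.continuous.comp (QuotientGroup.continuous_mk.comp continuous_inv)
  refine Vanishing.toricCoeff_eq_zero_of_forall_test_haar μ ν jT jT.continuous (wt β (star χ))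
    (continuous_wt_star β χ) (hasCompactSupport_wt_star β χ) (fun y : G => x (QuotientGroup.mk y⁻¹)) hvc ?_ h
  intro f hf hfs
  -- `conj ⟪E^χ_f, x⟫ = 0`, written as an integral over `G ⧸ Γ`
  have h0 : ∫ q, conj (x q) * EisQ Γ ν jT.toMonoidHom β χ f q ∂μQ = 0 := by
    have h1 := congrArg conj (horth ⟨⟨f, hf⟩, hfs⟩)
    rw [map_zero, conj_inner_EisL2_toLp] at h1
    exact h1
  -- unfold (Step 1 on the coset space) with the kernel `θ_y := y`, `ω(h) y := y (h⁻¹ • ·)`, at `y := conj x`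
  have hunf := KernelModel.unfolding_theta_quotient μ ν jT.toMonoidHom jT.continuous β β.continuous
    β.hasCompactSupport χ χ.continuous hΓ 𝓕 h𝓕 hμQ f hf hfs
    (X := G ⧸ Γ → ℂ) (fun y q => y q) (fun g y q => y (g⁻¹ • q)) (fun q => conj (x q))
    (Complex.continuous_conj.comp x.continuous) (fun _ _ => rfl)
  rw [hunf] at h0
  rw [← h0]
  congr 1
  ext g
  congr 1
  rw [← integral_conj]
  congr 1
  ext t
  rw [map_mul, conj_wt_star, MulAction.Quotient.smul_mk, smul_eq_mul, mul_inv_rev]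
  rfl

/-- The same with the translate written as `x(h⁻¹ • π (jT t)⁻¹)` (pv06-g3's `translC h x` evaluated at `π (jT t)⁻¹`). -/
theorem toricCoeff_eq_zero_of_orthogonal_EisL2_smul {μ : Measure G} (hM : IsCocompactHaarModel Γ μQ μ)
    (hΓ : DiscreteMeets Γ) (x : C(G ⧸ Γ, ℂ))
    (horth : ∀ f : C_c(G, ℂ), ⟪EisL2 μQ ν jT β χ hΓ f, ContinuousMap.toLp (E := ℂ) 2 μQ ℂ x⟫_ℂ = 0) (h : G) :
    ∫ t, wt β (star χ) t * x (h⁻¹ • QuotientGroup.mk (jT t)⁻¹) ∂ν = 0 := by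
  have := toricCoeff_eq_zero_of_orthogonal_EisL2 ν jT β χ hM hΓ x horth h
  simpa only [MulAction.Quotient.smul_mk, smul_eq_mul, mul_inv_rev] using this

/-- **pv06-g3's `unfold` field, literal shape, for any period model.**  If a functional `P` on `C(G ⧸ Γ, ℂ)` IS the
β-weighted toric period against `conj χ` (the identification a concrete `QuotientTorusDatum` makes for `PT (emb χ)`;
e.g. `P = toricPeriodCLM ν _ _ _`), then `x ⟂ 𝓔_χ` forces `P` to kill every translate `x(h⁻¹ • ·)` of `x`. -/
theorem unfold_of_periodModel {μ : Measure G} (hM : IsCocompactHaarModel Γ μQ μ) (hΓ : DiscreteMeets Γ)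
    (P : C(G ⧸ Γ, ℂ) → ℂ)
    (hP : ∀ y : C(G ⧸ Γ, ℂ), P y = ∫ t, wt β (star χ) t * y (QuotientGroup.mk (jT t)⁻¹) ∂ν)
    (transl : G → C(G ⧸ Γ, ℂ) → C(G ⧸ Γ, ℂ)) (htransl : ∀ h y q, transl h y q = y (h⁻¹ • q))
    (x : C(G ⧸ Γ, ℂ))
    (horth : ∀ f : C_c(G, ℂ), ⟪EisL2 μQ ν jT β χ hΓ f, ContinuousMap.toLp (E := ℂ) 2 μQ ℂ x⟫_ℂ = 0) (h : G) :
    P (transl h x) = 0 := by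
  rw [hP]
  simp only [htransl]
  exact toricCoeff_eq_zero_of_orthogonal_EisL2_smul ν jT β χ hM hΓ x horth h

/-- The canonical period model: `toricPeriodCLM` with `w = β conj χ`, `pt = π ∘ inv ∘ jT`. -/
theorem toricPeriodCLM_transl_eq_zero {μ : Measure G} (hM : IsCocompactHaarModel Γ μQ μ) (hΓ : DiscreteMeets Γ)
    (transl : G → C(G ⧸ Γ, ℂ) → C(G ⧸ Γ, ℂ)) (htransl : ∀ h y q, transl h y q = y (h⁻¹ • q))
    (x : C(G ⧸ Γ, ℂ))
    (horth : ∀ f : C_c(G, ℂ), ⟪EisL2 μQ ν jT β χ hΓ f, ContinuousMap.toLp (E := ℂ) 2 μQ ℂ x⟫_ℂ = 0) (h : G) :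
    toricPeriodCLM ν (continuous_wt_star β χ) (hasCompactSupport_wt_star β χ)
        (QuotientGroup.continuous_mk.comp (continuous_inv.comp jT.continuous) :
          Continuous fun t : T => (QuotientGroup.mk (jT t)⁻¹ : G ⧸ Γ))
        (transl h x) = 0 :=
  unfold_of_periodModel ν jT β χ hM hΓ _ (fun y => toricPeriodCLM_apply ν _ _ _ y) transl htransl x horth h

end Unfold

end RegularRep

end HodgeCM
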